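import Summits.QuantumAdvantage.QuantumAdvantage.Theses.DeterministicLeaf
import Summits.QuantumAdvantage.QuantumAdvantage.Theorems.GradeDialA

/-!
# Route `DeterministicLeaf`, support item `QuasiDetBridgeOdd` (stmt-QuantumAdvantage-28440) — closed BY NAME

The ring-grain bridge at the quasi grade, `RingQuasiLoss8Odd → DetSepOdd`, was proved and landed by the
decomp-qadv cell (lens-5 g25 «GradeDial», `Theorems.GradeDial.detSepOdd_of_ringQuasiLoss8Odd`, file
`Theorems/GradeDialA.lean`).  That theorem concludes `Theses.AbsorptionDial.DetSepOdd`; the route file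
`Theses/DeterministicLeaf.lean` declares its own (textually identical) `DetSepOdd` and the item
`QuasiDetBridgeOdd` with the hypothesis written inline.  This file is the one-line transport, so that the
ledger item closes on a theorem whose type is LITERALLY the route declaration.
-/

set_option linter.dupNamespace false

namespace Summit.QuantumAdvantage.QuantumAdvantage.Theorems.DeterministicLeaf

/-- Item stmt-QuantumAdvantage-28440 (`Theses.DeterministicLeaf.QuasiDetBridgeOdd`) holds: the quasi-polynomial
ring loss grade at every prime `p ≥ 5` gives `DetSepOdd` — by `GradeDial.detSepOdd_of_ringQuasiLoss8Odd`
(Razborov–Smolensky with error budget `(log₂ 8t)^A`), transported across the two syntactically identical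
copies of `DetSepOdd` (route files `AbsorptionDial` and `DeterministicLeaf`). -/
theorem quasiDetBridgeOdd_holds :
    Summit.QuantumAdvantage.QuantumAdvantage.Theses.DeterministicLeaf.QuasiDetBridgeOdd := by
  intro h
  have H := Summit.QuantumAdvantage.QuantumAdvantage.Theorems.GradeDial.detSepOdd_of_ringQuasiLoss8Odd h
  unfold Summit.QuantumAdvantage.QuantumAdvantage.Theses.AbsorptionDial.DetSepOdd at H
  unfold Summit.QuantumAdvantage.QuantumAdvantage.Theses.DeterministicLeaf.DetSepOdd
  exact H

end Summit.QuantumAdvantage.QuantumAdvantage.Theorems.DeterministicLeaf
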